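import Literature.NumberTheory.GaloisRepresentations.KroneckerWeberTheorem
import Literature.NumberTheory.GaloisRepresentations.InertiaLiftAbsoluteProofs
import Literature.NumberTheory.GaloisRepresentations.ArtinRestriction
import Literature.NumberTheory.GaloisRepresentations.ArtinLFunctionDirichletProofs
import HarnessLib

/-!
# Quadratic characters of `Γ_ℚ` unramified outside a finite set of primes are finitely many

Topic `NumberTheory/GaloisRepresentations`.  Theorems only (nothing is defined, no named fact).
For a finite set `s` of prime numbers, the open subgroups `U ≤ Γ_ℚ = Gal(ℚ̄/ℚ)` of index `2`
which contain the absolute inertia group `I_𝔓` of every maximal ideal `𝔓` of `\bar ℤ` not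
meeting `s` — the kernels of the continuous quadratic characters `ε : Γ_ℚ → {±1}` unramified
outside `s`, i.e. the groups `Gal(ℚ̄/K')` of the quadratic fields `K'/ℚ` unramified outside `s` —
all contain `Gal(ℚ̄/ℚ(ζ_n))` for `n = 8 ∏_{q ∈ s, q ≠ 2} q`
(`fixingSubgroup_adjoin_le_of_index_eq_two`), hence are **finite in number**
(`finite_setOf_index_eq_two_inertia_le`).

This is the finiteness input of step c) of the proof of Serre's open image theorem over `ℚ`
(J.-P. Serre, Invent. Math. 15 (1972), §4.2 c): "comme il n'y a qu'un nombre fini de telles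
extensions, on en déduit l'existence d'une partie infinie `L''` de `L'` et d'une extension
quadratique `K'` de `K` telles que `K'_l = K'` pour tout `l ∈ L''`" — there via Hermite's theorem
for everywhere unramified quadratic extensions of `K = K(E₁₂)`; over `ℚ` one needs the version
"unramified outside the bad primes", proved here through the Kronecker–Weber theorem with level
control, the tree's `le_of_index_eq_prime_pow` (Marcus, *Number Fields*, Ch. 4, Ex. 29–36):
an abelian field of degree `2` unramified outside `s ∋ 2` lies in `ℚ(ζ_n)`).

## Proof

Given such `U`: `U` is normal (index `2`), so `L = ℚ̄^U` is a quadratic, hence abelian, Galois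
number field inside `ℚ̄` with `Gal(ℚ̄/L) = U` (`fixingSubgroup_fixedField_of_isOpen`,
`finrank_fixedField_of_isOpen`).  Inside the abelian number field `M₀ = L(ζ_n)` the subfield `L`
is unramified at every prime `Q` of `M₀` not meeting `s`: for `g ∈ I(Q)` pick a prime `𝔓` of
`\bar ℤ` above `Q` (integrality of `\bar ℤ` over `𝓞 M₀`); `g` is the restriction of an element of
`I_𝔓` (inertia surjects onto inertia, the tree's `exists_mem_inertia_absRestrictNormalHom_eq`,
Serre, *Local Fields*, I §7 Prop. 22 b)), which lies in `U` by hypothesis and so fixes `L`.  Hence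
`L ≤ ℚ(ζ_n)` by `le_of_index_eq_prime_pow` (`p = 2`, `k = m = 1`), and
`Gal(ℚ̄/ℚ(ζ_n)) ≤ Gal(ℚ̄/L) = U`.  Finally the subgroups of `Γ_ℚ` containing the open normal
subgroup `Gal(ℚ̄/ℚ(ζ_n))` correspond to subgroups of the finite group `Gal(ℚ(ζ_n)/ℚ)`.

## References

* [Serre1972] J.-P. Serre, Invent. Math. 15 (1972) 259–331, §4.2 c).
* [Marcus2018] D. A. Marcus, *Number Fields*, 2nd ed. (2018), Ch. 4, Ex. 29–36; Ch. 4 Thm. 28.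
* [SerreLocalFields1979] J.-P. Serre, *Local Fields*, GTM 67, Ch. I §7, Prop. 22 b).
-/

noncomputable section

open NumberField Ideal Field
open scoped Pointwise IsMulCommutative

namespace Literature.NumberTheory.GaloisRepresentations

open Literature.NumberTheory.NumberFields

/-- **An open subgroup of index `2` of `Γ_ℚ` unramified outside `s ∋ 2` contains
`Gal(ℚ̄/ℚ(ζ_n))`, `n = 8 ∏_{q ∈ s ∖ {2}} q`** — i.e. a quadratic field unramified outside `s`
lies in `ℚ(ζ_n)` (Kronecker–Weber with level control, the tree's `le_of_index_eq_prime_pow`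
after Marcus, Ch. 4, Ex. 29–36).  "Unramified outside `s`" is the condition that `U` contains the
absolute inertia group of every maximal ideal of `\bar ℤ` containing no `q ∈ s`.
[cite: Marcus2018, Ch. 4, Ex. 29–36] -/
theorem fixingSubgroup_adjoin_le_of_index_eq_two (s : Finset ℕ) (hsprime : ∀ q ∈ s, q.Prime)
    (h2s : 2 ∈ s) {ζ : AlgebraicClosure ℚ}
    (hζ : IsPrimitiveRoot ζ (2 ^ 3 * ∏ q ∈ s.erase 2, q))
    (U : Subgroup (absoluteGaloisGroup ℚ)) (hUopen : IsOpen (U : Set (absoluteGaloisGroup ℚ)))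
    (hUind : U.index = 2)
    (hUI : ∀ (𝔓 : Ideal (absIntegers (𝓞 ℚ) ℚ)), 𝔓.IsMaximal →
      (∀ q ∈ s, (q : absIntegers (𝓞 ℚ) ℚ) ∉ 𝔓) →
        𝔓.inertia (absoluteGaloisGroup ℚ) ≤ U) :
    ((IntermediateField.adjoin ℚ {ζ}).fixingSubgroup : Subgroup (absoluteGaloisGroup ℚ)) ≤ U := by
  classical
  haveI : Algebra.IsAlgebraic ℚ (AlgebraicClosure ℚ) := AlgebraicClosure.isAlgebraic ℚ
  haveI : Normal ℚ (AlgebraicClosure ℚ) :=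
    @IsAlgClosure.normal ℚ (AlgebraicClosure ℚ) _ _ (AlgebraicClosure.instAlgebra ℚ) inferInstance
  haveI : IsGalois ℚ (AlgebraicClosure ℚ) :=
    @IsAlgClosure.isGalois ℚ (AlgebraicClosure ℚ) _ _ (AlgebraicClosure.instAlgebra ℚ) inferInstance
      inferInstance
  -- the quadratic field `L = ℚ̄^U`
  haveI hUn : U.Normal := Subgroup.normal_of_index_eq_two hUind
  set L : IntermediateField ℚ (AlgebraicClosure ℚ) := IntermediateField.fixedField U with hLdef
  have hLU : L.fixingSubgroup = U := fixingSubgroup_fixedField_of_isOpen U hUopen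
  haveI hfd : FiniteDimensional ℚ L := finiteDimensional_fixedField_of_isOpen U hUopen
  have hkL : Module.finrank ℚ L = 2 ^ 1 := by
    have h := finrank_fixedField_of_isOpen U hUopen
    rw [hUind] at h
    exact h.trans (pow_one 2).symm
  haveI hGal : IsGalois ℚ L := by
    have h : L.fixingSubgroup.Normal := by rw [hLU]; exact hUn
    exact (InfiniteGalois.normal_iff_isGalois L).mp h
  haveI : IsMulCommutative (L ≃ₐ[ℚ] L) := by
    haveI : Fact (Nat.card (L ≃ₐ[ℚ] L)).Prime := by
      rw [IsGalois.card_aut_eq_finrank, hkL, pow_one]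
      exact ⟨Nat.prime_two⟩
    haveI : IsCyclic (L ≃ₐ[ℚ] L) := isCyclic_of_prime_card rfl
    exact IsCyclic.isMulCommutative
  haveI hab : IsAbelianGalois ℚ L := ⟨⟩
  haveI : NumberField L := NumberField.mk
  -- the level `n` and the cyclotomic field `C = ℚ(ζ)`
  set n : ℕ := 2 ^ 3 * ∏ q ∈ s.erase 2, q with hn
  have hn0 : 0 < n :=
    Nat.mul_pos (pow_pos two_pos _)
      (Finset.prod_pos fun q hq => (hsprime q (Finset.mem_of_mem_erase hq)).pos)
  have hpn : 2 ^ (1 + 2) ∣ n := Dvd.intro _ rfl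
  have hsn : ∀ q ∈ s, q ∣ n := by
    intro q hq
    by_cases hq2 : q = 2
    · rw [hq2]; exact (dvd_pow_self 2 (by omega)).trans hpn
    · exact (Finset.dvd_prod_of_mem (fun q => q) (Finset.mem_erase.mpr ⟨hq2, hq⟩)).trans
        (dvd_mul_left _ _)
  haveI : NeZero n := ⟨hn0.ne'⟩
  haveI : NeZero (n : ℚ) := ⟨by exact_mod_cast hn0.ne'⟩
  set C : IntermediateField ℚ (AlgebraicClosure ℚ) := IntermediateField.adjoin ℚ {ζ} with hC
  haveI : IsCyclotomicExtension {n} ℚ C :=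
    hζ.intermediateField_adjoin_isCyclotomicExtension (K := ℚ)
  haveI : FiniteDimensional ℚ C :=
    IntermediateField.adjoin.finiteDimensional (Algebra.IsIntegral.isIntegral ζ)
  haveI : IsAbelianGalois ℚ C := IsCyclotomicExtension.isAbelianGalois {n} ℚ C
  set M₀ : IntermediateField ℚ (AlgebraicClosure ℚ) := L ⊔ C with hM₀
  haveI : FiniteDimensional ℚ M₀ := IntermediateField.finiteDimensional_sup L C
  haveI : IsAbelianGalois ℚ M₀ :=
    @isAbelianGalois_sup ℚ (AlgebraicClosure ℚ) _ _ (_) _ L C hfd hab inferInstance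
      (IsCyclotomicExtension.isAbelianGalois {n} ℚ C)
  haveI : NumberField M₀ := NumberField.mk
  haveI hM₀normal : Normal ℚ M₀ := inferInstance
  have hLM : L ≤ M₀ := le_sup_left
  have hCM : C ≤ M₀ := le_sup_right
  -- `F₀ = L` and `T = ℚ(ζ)` as subfields of `M₀`
  set F₀ : IntermediateField ℚ M₀ := IntermediateField.restrict hLM with hF₀
  set ζ' : M₀ := ⟨ζ, hCM (IntermediateField.mem_adjoin_simple_self ℚ ζ)⟩ with hζ'
  have hζ'prim : IsPrimitiveRoot ζ' n := IsPrimitiveRoot.coe_submonoidClass_iff.mp hζ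
  set T : IntermediateField ℚ M₀ := IntermediateField.adjoin ℚ {ζ'} with hT
  have hCyc : ∀ d : ℕ, d ∣ n →
      ∃ Cy : IntermediateField ℚ M₀, Cy ≤ T ∧ IsCyclotomicExtension {d} ℚ Cy := by
    intro d hd
    obtain ⟨e, he⟩ := hd
    haveI : NeZero d := ⟨left_ne_zero_of_mul (he ▸ hn0.ne')⟩
    have hprim : IsPrimitiveRoot (ζ' ^ e) d := hζ'prim.pow hn0 (by rw [he, mul_comm])
    refine ⟨IntermediateField.adjoin ℚ {ζ' ^ e}, ?_,
      hprim.intermediateField_adjoin_isCyclotomicExtension (K := ℚ)⟩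
    rw [IntermediateField.adjoin_simple_le_iff]
    exact pow_mem (IntermediateField.mem_adjoin_simple_self ℚ ζ') e
  -- the degree of `F₀`
  have hF₀fin : Module.finrank ℚ F₀ = 2 ^ 1 := by
    rw [← hkL]
    exact (IntermediateField.restrict_algEquiv hLM).toLinearEquiv.finrank_eq.symm
  have hF₀i : F₀.fixingSubgroup.index = 2 ^ 1 := (index_fixingSubgroup F₀).trans hF₀fin
  -- `F₀ ≅ L` is unramified at the primes of `M₀` not meeting `s`
  have hF₀u : ∀ (Q : Ideal (𝓞 M₀)) [Q.IsMaximal], (∀ q ∈ s, (q : 𝓞 M₀) ∉ Q) →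
      Q.inertia (M₀ ≃ₐ[ℚ] M₀) ≤ F₀.fixingSubgroup := by
    intro Q _ hQ g hg
    -- the inclusion `φ : 𝓞 M₀ → \bar ℤ` and a prime `𝔓` of `\bar ℤ` above `Q`
    set φ : 𝓞 M₀ →+* absIntegers (𝓞 ℚ) ℚ :=
      EllipticCurves.ringOfIntegersToIntegralClosure (k := ℚ) (Ω := AlgebraicClosure ℚ) M₀
      with hφ
    have hφalg : ∀ x : 𝓞 ℚ, φ (algebraMap (𝓞 ℚ) (𝓞 M₀) x) =
        algebraMap (𝓞 ℚ) (absIntegers (𝓞 ℚ) ℚ) x := fun x ↦ rfl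
    obtain ⟨𝔓, h𝔓prime, h𝔓Q⟩ : ∃ 𝔓 : Ideal (absIntegers (𝓞 ℚ) ℚ), 𝔓.IsPrime ∧ 𝔓.comap φ = Q := by
      letI : Algebra (𝓞 M₀) (absIntegers (𝓞 ℚ) ℚ) := φ.toAlgebra
      haveI : IsScalarTower (𝓞 ℚ) (𝓞 M₀) (absIntegers (𝓞 ℚ) ℚ) :=
        IsScalarTower.of_algebraMap_eq fun x ↦ (hφalg x).symm
      haveI : Algebra.IsIntegral (𝓞 M₀) (absIntegers (𝓞 ℚ) ℚ) :=
        ⟨fun x ↦ (Algebra.IsIntegral.isIntegral (R := 𝓞 ℚ) x).tower_top⟩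
      obtain ⟨𝔓, -, h𝔓prime, h𝔓Q⟩ := Ideal.exists_ideal_over_prime_of_isIntegral Q
        (⊥ : Ideal (absIntegers (𝓞 ℚ) ℚ))
        (fun x hx ↦ by
          rw [Ideal.mem_comap, Ideal.mem_bot] at hx
          have hx0 : x = 0 :=
            EllipticCurves.ringOfIntegersToIntegralClosure_injective M₀
              (hx.trans (map_zero _).symm)
          rw [hx0]
          exact Q.zero_mem)
      exact ⟨𝔓, h𝔓prime, h𝔓Q⟩
    haveI := h𝔓prime
    -- `𝔓` is maximal and does not meet `s`
    have h𝔓max : 𝔓.IsMaximal := by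
      letI : Algebra (𝓞 M₀) (absIntegers (𝓞 ℚ) ℚ) := φ.toAlgebra
      haveI : IsScalarTower (𝓞 ℚ) (𝓞 M₀) (absIntegers (𝓞 ℚ) ℚ) :=
        IsScalarTower.of_algebraMap_eq fun x ↦ (hφalg x).symm
      haveI : Algebra.IsIntegral (𝓞 M₀) (absIntegers (𝓞 ℚ) ℚ) :=
        ⟨fun x ↦ (Algebra.IsIntegral.isIntegral (R := 𝓞 ℚ) x).tower_top⟩
      refine Ideal.isMaximal_of_isIntegral_of_isMaximal_comap (R := 𝓞 M₀) 𝔓 ?_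
      rw [show Ideal.comap (algebraMap (𝓞 M₀) (absIntegers (𝓞 ℚ) ℚ)) 𝔓 = Q from h𝔓Q]
      infer_instance
    have h𝔓s : ∀ q ∈ s, (q : absIntegers (𝓞 ℚ) ℚ) ∉ 𝔓 := by
      intro q hq hmem
      apply hQ q hq
      rw [← h𝔓Q, Ideal.mem_comap]
      have : φ (q : 𝓞 M₀) = (q : absIntegers (𝓞 ℚ) ℚ) := by
        rw [← map_natCast (algebraMap (𝓞 ℚ) (𝓞 M₀)) q, hφalg, map_natCast]
      rw [this]
      exact hmem
    -- `g` is an inertia element at `𝔓 ∩ M₀` in the form used by the inertia lift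
    have hg' : g ∈ (𝔓.comap (M₀.integralClosureToAbsIntegers (𝓞 ℚ))).inertia (M₀ ≃ₐ[ℚ] M₀) := by
      intro x
      set y : 𝓞 M₀ := ⟨(x : M₀), isIntegral_int_of_isIntegral x.2⟩ with hy
      have h : φ (g • y - y) ∈ 𝔓 := by
        have := hg y
        rw [← h𝔓Q, Submodule.mem_toAddSubgroup, Ideal.mem_comap] at this
        exact this
      have e : φ (g • y - y) = M₀.integralClosureToAbsIntegers (𝓞 ℚ) (g • x - x) := Subtype.ext rfl
      rw [e] at h
      exact h
    -- lift `g` to the absolute inertia group, which lies in `U = Gal(ℚ̄/L)`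
    obtain ⟨σ, hσI, hσg⟩ := @exists_mem_inertia_absRestrictNormalHom_eq ℚ _ (𝓞 ℚ) _ _ 𝔓 h𝔓prime M₀
      inferInstance hM₀normal g hg'
    have hσU : σ ∈ U := hUI 𝔓 h𝔓max h𝔓s hσI
    rw [← hLU] at hσU
    rw [IntermediateField.mem_fixingSubgroup_iff]
    intro x hx
    have hxL : ((x : M₀) : AlgebraicClosure ℚ) ∈ L := (IntermediateField.mem_restrict hLM x).mp hx
    have h1 : ((g x : M₀) : AlgebraicClosure ℚ) = σ • ((x : M₀) : AlgebraicClosure ℚ) := by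
      rw [← hσg]
      exact @AlgEquiv.restrictNormalHom_apply ℚ _ (AlgebraicClosure ℚ) _ _ M₀ hM₀normal
        (absoluteGaloisGroup.toAlgEquiv ℚ σ) x
    have h2 : σ • ((x : M₀) : AlgebraicClosure ℚ) = ((x : M₀) : AlgebraicClosure ℚ) :=
      (mem_fixingSubgroup_iff_forall_smul L σ).mp hσU ⟨_, hxL⟩
    exact Subtype.ext (h1.trans h2)
  -- inside `M₀`: `F₀ ≤ T = ℚ(ζ)`
  have hle : F₀ ≤ T :=
    le_of_index_eq_prime_pow Nat.prime_two hpn T hCyc s.card s F₀ 1 le_rfl le_rfl h2s hsprime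
      hsn hF₀i hF₀u
  -- back in `ℚ̄`: `L ≤ ℚ(ζ)`, hence `Gal(ℚ̄/ℚ(ζ)) ≤ Gal(ℚ̄/L) = U`
  have h1 : L = IntermediateField.lift F₀ := (IntermediateField.lift_restrict hLM).symm
  have h2 : IntermediateField.lift T = IntermediateField.adjoin ℚ {ζ} :=
    IntermediateField.lift_adjoin_simple (K := M₀) (α := ζ')
  have h3 : IntermediateField.lift F₀ ≤ IntermediateField.lift T := by
    intro x hx
    have hxM : x ∈ M₀ := IntermediateField.lift_le F₀ hx
    exact (IntermediateField.mem_lift (⟨x, hxM⟩ : M₀)).2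
      (hle ((IntermediateField.mem_lift (⟨x, hxM⟩ : M₀)).1 hx))
  have h4 : L ≤ IntermediateField.adjoin ℚ {ζ} := by
    rw [h1]; exact h3.trans h2.le
  rw [← hLU]
  exact IntermediateField.fixingSubgroup_antitone h4

/-- **Finiteness of the quadratic characters of `Γ_ℚ` unramified outside a finite set of
primes `s`**: the open subgroups `U ≤ Γ_ℚ` of index `2` containing the absolute inertia groups of
all maximal ideals of `\bar ℤ` not meeting `s` form a finite set (they all contain the open normal
subgroup `Gal(ℚ̄/ℚ(ζ_n))`, `n = 8 ∏_{q ∈ s ∪ {2}, q ≠ 2} q`,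
`fixingSubgroup_adjoin_le_of_index_eq_two`).
Over `ℚ` this replaces, in step c) of Serre's proof of the open image theorem, the finiteness of
the unramified quadratic extensions of `K` ("il n'y a qu'un nombre fini de telles extensions").
[cite: Serre1972, §4.2 c)] -/
theorem finite_setOf_index_eq_two_inertia_le (s : Finset ℕ) (hsprime : ∀ q ∈ s, q.Prime) :
    {U : Subgroup (absoluteGaloisGroup ℚ) | IsOpen (U : Set (absoluteGaloisGroup ℚ)) ∧
      U.index = 2 ∧
      ∀ (𝔓 : Ideal (absIntegers (𝓞 ℚ) ℚ)), 𝔓.IsMaximal →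
        (∀ q ∈ s, (q : absIntegers (𝓞 ℚ) ℚ) ∉ 𝔓) →
          𝔓.inertia (absoluteGaloisGroup ℚ) ≤ U}.Finite := by
  classical
  haveI : Algebra.IsAlgebraic ℚ (AlgebraicClosure ℚ) := AlgebraicClosure.isAlgebraic ℚ
  haveI : Normal ℚ (AlgebraicClosure ℚ) :=
    @IsAlgClosure.normal ℚ (AlgebraicClosure ℚ) _ _ (AlgebraicClosure.instAlgebra ℚ) inferInstance
  haveI : IsGalois ℚ (AlgebraicClosure ℚ) :=
    @IsAlgClosure.isGalois ℚ (AlgebraicClosure ℚ) _ _ (AlgebraicClosure.instAlgebra ℚ) inferInstance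
      inferInstance
  -- enlarge `s` by `2` and fix a primitive `n`-th root of unity
  set s' : Finset ℕ := insert 2 s with hs'
  have hs'prime : ∀ q ∈ s', q.Prime := by
    intro q hq
    rw [hs', Finset.mem_insert] at hq
    rcases hq with rfl | hq
    · exact Nat.prime_two
    · exact hsprime q hq
  set n : ℕ := 2 ^ 3 * ∏ q ∈ s'.erase 2, q with hn
  have hn0 : 0 < n :=
    Nat.mul_pos (pow_pos two_pos _)
      (Finset.prod_pos fun q hq => (hs'prime q (Finset.mem_of_mem_erase hq)).pos)
  haveI : NeZero n := ⟨hn0.ne'⟩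
  haveI : NeZero (n : ℚ) := ⟨by exact_mod_cast hn0.ne'⟩
  obtain ⟨ζ, hζ⟩ := HasEnoughRootsOfUnity.exists_primitiveRoot (AlgebraicClosure ℚ) n
  set C : IntermediateField ℚ (AlgebraicClosure ℚ) := IntermediateField.adjoin ℚ {ζ} with hC
  haveI : IsCyclotomicExtension {n} ℚ C :=
    hζ.intermediateField_adjoin_isCyclotomicExtension (K := ℚ)
  haveI : FiniteDimensional ℚ C :=
    IntermediateField.adjoin.finiteDimensional (Algebra.IsIntegral.isIntegral ζ)
  haveI hCgal : IsGalois ℚ C := IsCyclotomicExtension.isGalois {n} ℚ C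
  set V : Subgroup (absoluteGaloisGroup ℚ) := C.fixingSubgroup with hV
  -- every `U` in the set contains `V`
  have hVU : ∀ U ∈ {U : Subgroup (absoluteGaloisGroup ℚ) |
      IsOpen (U : Set (absoluteGaloisGroup ℚ)) ∧ U.index = 2 ∧
        ∀ (𝔓 : Ideal (absIntegers (𝓞 ℚ) ℚ)), 𝔓.IsMaximal →
          (∀ q ∈ s, (q : absIntegers (𝓞 ℚ) ℚ) ∉ 𝔓) →
            𝔓.inertia (absoluteGaloisGroup ℚ) ≤ U}, V ≤ U := by
    rintro U ⟨hUo, hUi, hUI⟩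
    refine fixingSubgroup_adjoin_le_of_index_eq_two s' hs'prime (Finset.mem_insert_self 2 s) hζ U
      hUo hUi fun 𝔓 h𝔓 h𝔓s ↦ hUI 𝔓 h𝔓 fun q hq ↦ h𝔓s q (Finset.mem_insert_of_mem hq)
  -- `V` is normal of finite index, so the subgroups containing it are finitely many
  haveI hVn : V.Normal := by
    have h : C.fixingSubgroup.Normal :=
      (InfiniteGalois.normal_iff_isGalois C).mpr (by exact hCgal)
    exact h
  have hVi : V.index ≠ 0 := by
    have h : V.index = Module.finrank ℚ C :=
      (IntermediateField.finrank_eq_fixingSubgroup_index C).symm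
    rw [h]
    exact Module.finrank_pos.ne'
  haveI : V.FiniteIndex := ⟨hVi⟩
  haveI : Finite (absoluteGaloisGroup ℚ ⧸ V) := Subgroup.finite_quotient_of_finiteIndex
  haveI : Finite (Subgroup (absoluteGaloisGroup ℚ ⧸ V)) :=
    Finite.of_injective _ SetLike.coe_injective
  refine Set.Finite.of_injOn (f := fun U : Subgroup (absoluteGaloisGroup ℚ) ↦
      U.map (QuotientGroup.mk' V)) (Set.mapsTo_univ _ _) ?_ Set.finite_univ
  intro U₁ hU₁ U₂ hU₂ h
  have h1 : (U₁.map (QuotientGroup.mk' V)).comap (QuotientGroup.mk' V) = U₁ :=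
    Subgroup.comap_map_eq_self (by rw [QuotientGroup.ker_mk']; exact hVU U₁ hU₁)
  have h2 : (U₂.map (QuotientGroup.mk' V)).comap (QuotientGroup.mk' V) = U₂ :=
    Subgroup.comap_map_eq_self (by rw [QuotientGroup.ker_mk']; exact hVU U₂ hU₂)
  rw [← h1, ← h2]
  exact congrArg _ h

end Literature.NumberTheory.GaloisRepresentations
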